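import Mathlib
import Literature.Topology.FourManifolds.PlanarAchiralWords
import Summits.SmoothPoincare4.SmoothPoincare4.Theorems.ConvexBisectionPlanarAcyclicBisectionRigidityStubWalkLow
import HarnessLib

/-!
# Crux `ConvexBisection.PlanarAcyclicBisectionRigidity`, line Sketch — stub `stub_walkLowDouble`

Doubles-only re-cut of the landed walk `stub_walkLow` for integral homotopy-sphere words
`(n; A, B)` with `n ≤ 2` letters: every exit of that walk is an honest double (`TwistEq`), never the
`SeamTrivial` disjunct, so the same argument proves the sharper codomain.  All infrastructure (the
`ArcData` monoid laws, the classification of in-range twists on two holes as `T_[0,0]`, `T_[1,1]`,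
`T_[0,1]`, the exponent-sum separation and the Hurwitz bookkeeping) is reused from the sub-namespace
`WalkLow` of the landed module; only the two short terminal proofs are re-run with the new codomain
(sub-namespace `WalkLowDouble`).
-/

noncomputable section

open Literature.Topology.FourManifolds.PlanarWords

set_option linter.dupNamespace false

namespace Summit.SmoothPoincare4.SmoothPoincare4.Theorems.PlanarAcyclicBisectionRigidity.Sketch

namespace WalkLowDouble

open ArcData WalkLow

/-- The case `n = 2`, doubles only: zero or one Hurwitz move reaches an honest double. [folklore] -/
theorem walk_two_double (c₁ c₂ d₁ d₂ : PlanarCurve) (h₁ : c₁.InRange 2) (h₂ : c₂.InRange 2)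
    (h₃ : d₁.InRange 2) (h₄ : d₂.InRange 2)
    (hmon : monodromy 2 (positiveWord [c₁, c₂]) = monodromy 2 (positiveWord [d₁, d₂])) :
    ∃ (n' : ℕ) (A' B' : List PlanarCurve),
      Reachable (2, blockForm [c₁, c₂] [d₁, d₂]) (n', blockForm A' B') ∧ TwistEq n' A' B' := by
  obtain ⟨t₁, ht₁⟩ := twist_classify c₁ h₁
  obtain ⟨t₂, ht₂⟩ := twist_classify c₂ h₂
  obtain ⟨s₁, hs₁⟩ := twist_classify d₁ h₃
  obtain ⟨s₂, hs₂⟩ := twist_classify d₂ h₄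
  have hdeg : t₁.deg + t₂.deg = s₁.deg + s₂.deg := by
    rw [← D_R, ← D_R, ← D_R, ← D_R, ← D_mul _ _ (R_perm _ _), ← D_mul _ _ (R_perm _ _), ← ht₁, ← ht₂,
      ← hs₁, ← hs₂, ← monodromy_two, ← monodromy_two, hmon]
  rcases Ty.key _ _ _ _ hdeg with ⟨rfl, rfl⟩ | ⟨rfl, rfl⟩
  · exact ⟨2, [c₁, c₂], [d₁, d₂], Reachable.refl _,
      List.Forall₂.cons (ht₁.trans hs₁.symm) (List.Forall₂.cons (ht₂.trans hs₂.symm) List.Forall₂.nil)⟩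
  · exact ⟨2, [c₁, c₂], [d₂, (hurwitzAct (d₂, false) (d₁, false)).1],
      Move.reachable (Move.hurwitz 2 [(c₁, true), (c₂, true)] [] (d₂, false) (d₁, false)),
      List.Forall₂.cons (ht₁.trans hs₂.symm) (List.Forall₂.cons
        (ht₂.trans (hurwitz_twist d₁ d₂ h₄ _ _ hs₁ hs₂).symm) List.Forall₂.nil)⟩

end WalkLowDouble

/-- **Stub 4 of the line Sketch, doubles-only form — THE WALK FOR `n ≤ 2` LETTERS (`k ≤ 3` binding
components).**  Every integral homotopy-sphere word `(n; A, B)` with `n ≤ 2` walks (by at most one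
signed Hurwitz move, no stabilisation) to a block form whose two blocks are twist-equal (an honest
double).  `n = 0`: the empty word; `n = 1`: `monodromy_eq` is literally `TwistEq 1 [a] [b]`;
`n = 2`: every positive twist about an in-range curve on two holes equals `T_[0,0]`, `T_[1,1]` or
`T_[0,1]` as arc data (`WalkLow.twist_classify`), these commute and their pairwise products are
separated by the exponent-sum vector, so the two factorisations agree as multisets; if they agree
in order no move is needed, otherwise one Hurwitz move on the negative pair swaps them
semantically (`WalkLow.hurwitz_twist`).  Unimodularity and normal generation are not needed.
[folklore] -/
theorem stub_walkLowDouble (n : ℕ) (A B : List PlanarCurve) (hw : IsIntegralSphereWord n A B) (hn : n ≤ 2) :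
    ∃ (n' : ℕ) (A' B' : List PlanarCurve),
      Reachable (n, blockForm A B) (n', blockForm A' B') ∧ TwistEq n' A' B' := by
  obtain ⟨hin, hA, hB, hmon, -, -, -⟩ := hw
  interval_cases n
  · obtain rfl : A = [] := List.eq_nil_of_length_eq_zero hA
    obtain rfl : B = [] := List.eq_nil_of_length_eq_zero hB
    exact ⟨0, [], [], Reachable.refl _, TwistEq.refl 0 []⟩
  · obtain ⟨a, rfl⟩ := List.length_eq_one_iff.1 hA
    obtain ⟨b, rfl⟩ := List.length_eq_one_iff.1 hB
    refine ⟨1, [a], [b], Reachable.refl _, List.Forall₂.cons ?_ List.Forall₂.nil⟩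
    simpa [monodromy, positiveWord, Letter.twistWord] using hmon
  · obtain ⟨c₁, c₂, rfl⟩ := List.length_eq_two.1 hA
    obtain ⟨d₁, d₂, rfl⟩ := List.length_eq_two.1 hB
    exact WalkLowDouble.walk_two_double c₁ c₂ d₁ d₂ (hin c₁ (by simp)) (hin c₂ (by simp))
      (hin d₁ (by simp)) (hin d₂ (by simp)) hmon

end Summit.SmoothPoincare4.SmoothPoincare4.Theorems.PlanarAcyclicBisectionRigidity.Sketch

end
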